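import Mathlib.NumberTheory.NumberField.Basic
import Mathlib.NumberTheory.NumberField.InfinitePlace.Embeddings
import Mathlib.NumberTheory.Padics.PadicNumbers
import Mathlib.NumberTheory.Padics.PadicIntegers
import Mathlib.RingTheory.AdjoinRoot
import Mathlib.RingTheory.IntegralClosure.IntegrallyClosed
import Mathlib.AlgebraicGeometry.EllipticCurve.Affine.Point
import Literature.NumberTheory.EllipticCurves.Selmer
import Literature.NumberTheory.EllipticCurves.Tamagawa
import Literature.NumberTheory.EllipticCurves.BSDRankZeroDensity
import HarnessLib

/-!
# Bounds for the `2`-Selmer rank of an elliptic curve by the modified narrow class group of its cubic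
# `2`-division field (Barrera Salazar–Pacetti–Tornaría 2021, Thm. 2.16) — the case `K = ℚ`

Source: D. Barrera Salazar, A. Pacetti, G. Tornaría, *On 2-Selmer groups and quadratic twists of elliptic curves*,
Math. Res. Lett. 28 (2021), arXiv:2001.02263 [cite: BarrerasalazarPacettiTornaria2021].  We vendor, for the base field
`K = ℚ` (the only case the tree's dependents use; `-- TODO(general form)` below), the paper's

* setting (§1): `E : y² = F(x)` with `F(x) = x³ + a₂x² + a₄x + a₆ ∈ ℤ[x]` monic cubic square-free, the cubic algebra
  `A_ℚ = ℚ[T]/(F(T))` — a cubic number FIELD `A` once `E(ℚ)[2] = 0` (Hypotheses 2.1), presented here as an abstract number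
  field `A` of degree `3` with a root `θ` of `F` (then `A = ℚ(θ) ≅ ℚ[T]/(F)` canonically, `T ↦ θ`);
* **Definition 1.6 (†)** at a prime `p` (local, four alternatives (†.i)–(†.iv)) — `SatisfiesDaggerAt`;
* **Hypotheses 2.1** for `K = ℚ` — `Hypotheses21` (the narrow class number of `ℚ` is `1`, odd: automatic);
* the distinguished real place (Remark 1.2, Lemma 1.1: the place of the SMALLEST root `θ₁ < θ₂ < θ₃`) and
  **Definition 2.8**: `P₊ ⊂ P_*(E) ⊂ P`, `Cl_*(A_K,E) := Frac(A_K)/P_*(E)` — typed, exactly as the tree types ray class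
  2-ranks (`Summit…ANg21.quadraticRayClassCharacters`), WITHOUT a class-group object: `IsPStarIdeal` = «integral ideal in
  `P_*(E)`» and `clStarQuadraticCharacters` = the quadratic characters of `Frac(A)/P_*(E)` as functions on integral ideals, so
  that `Nat.card (clStarQuadraticCharacters …) = #Hom(Cl_*(A,E), ±1) = #Cl_*(A,E)[2] = 2 ^ dim_{𝔽₂} Cl_*(A,E)[2]`;
* **Theorem 2.16** for `K = ℚ` as the NAMED FACT `twoSelmerRank_clStar_bounds`:
  `dim Cl_*(A,E)[2] ≤ dim Sel₂(E/ℚ) ≤ dim Cl_*(A,E)[2] + 1`;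
* proved API: the trivial character is a member (`one_mem_clStarQuadraticCharacters`), and the paper's remark «if
  `Disc(E) < 0` then `Cl_*(A_ℚ,E) = Cl(A_ℚ)`» in the form: with at most one real embedding the `P_*`-condition is vacuous
  (`isPStarIdeal_iff_of_subsingleton`, `clStarQuadraticCharacters_eq_of_subsingleton`).

Design: `2`-Selmer group = the tree's `WeierstrassCurve.selmerGroup W 2` (`Literature/…/Selmer.lean`, cohomological, `K = ℚ`);
Tamagawa index `[E(ℚ_p) : E₀(ℚ_p)]` = the tree's `localTamagawaNumber` on `ℤ_[p]`; good reduction at `2` = the tree's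
`HasGoodReductionAtPrime`; (†.i) «`A_{ℚ_p}` is a field» = `F` irreducible over `ℚ_[p]`; (†.ii) «`A_{ℤ_p} = ℤ_p[T]/(F(T))`» (the
monogenic `ℤ_p`-order is the maximal order = the integral closure of `ℤ_p` in `ℚ_p[T]/(F)`) = `IsIntegrallyClosed (AdjoinRoot F_{ℤ_p})`
(integrally closed in its total ring of fractions `ℚ_p[T]/(F)`).  NOT here: the general number field `K` (types (i)/(ii)/(iii) of
archimedean places, `[K:ℚ]` in the upper bound), the parity remark «if `K = ℚ` the order of `Sel₂` is determined by `Cl_*[2]` and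
the root number» is NOT part of the named fact (it combines Thm 2.16 with the 2-Selmer parity theorem) but is PROVED here from the
fact and the tree's parity fact `even_selmerRank_sub_torsionRank_iff` (`natCard_selmerGroup_eq_of_rootNumber`); §3 (quadratic twists)
and §4 (examples) are not vendored.  Written for cell `bsd-f1-sign2` (typer -ty g16; asked by -an D-an-118 and REF2 v47 §20 as the
print input of the rank-1 descent decider S38i).
-/

noncomputable section

open scoped Classical
open Polynomial NumberField

namespace Literature.NumberTheory.EllipticCurves.BPT2021

/-! ## §1 The setting over `ℚ`: `E : y² = F(x)`, `F = x³ + a₂x² + a₄x + a₆ ∈ ℤ[x]` -/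

/-- The Weierstrass model `E : y² = x³ + a₂x² + a₄x + a₆` over `ℚ` with `a₂ a₄ a₆ ∈ ℤ` (`a₁ = a₃ = 0`) — the shape
`y² = F(x)`, `F ∈ 𝒪_K[x]` monic cubic, of BPT 2021 §1 for `K = ℚ`.  `F` square-free ⟺ this curve is elliptic
(`Δ = 16·disc F`). [cite: BarrerasalazarPacettiTornaria2021, §1 (setting)] -/
def curve (a₂ a₄ a₆ : ℤ) : WeierstrassCurve ℚ :=
  { a₁ := 0, a₂ := a₂, a₃ := 0, a₄ := a₄, a₆ := a₆ }

/-- The monic cubic `F(T) = T³ + a₂T² + a₄T + a₆ ∈ ℤ[T]` of the model `curve a₂ a₄ a₆ : y² = F(x)`; the cubic algebra of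
the paper is `A_K = K[T]/(F(T))`. [cite: BarrerasalazarPacettiTornaria2021, §1 (setting)] -/
def cubicF (a₂ a₄ a₆ : ℤ) : ℤ[X] :=
  X ^ 3 + C a₂ * X ^ 2 + C a₄ * X + C a₆

/-! ## Definition 1.6: the local condition (†) at a prime `p` -/

/-- **BPT 2021 Definition 1.6, condition (†) for `E : y² = F(x)` over `K = ℚ_p`** (verbatim): «`F(x) ∈ 𝒪[x]` is a monic cubic
square-free polynomial and any of the following conditions holds: (i) `A_K` is a field extension of `K`, or (ii)
`A_𝒪 = 𝒪[T]/(F(T))`, or (iii) `char(k) > 2` and `[E(K) : E₀(K)]` is odd, where `E₀(K)` is the subgroup of the points of `E(K)`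
whose reduction is non-singular, or (iv) `char(k) = 2`, `K/ℚ₂` is unramified, and `E` has good reduction.»  Here `K = ℚ_p`,
`𝒪 = ℤ_p`, `F = cubicF a₂ a₄ a₆` (monic, in `ℤ[x] ⊂ ℤ_p[x]`; square-freeness is carried by the ellipticity hypothesis of the users),
`A_K = ℚ_p[T]/(F)` and `A_𝒪` = the ring of integers of `A_K` (the integral closure of `ℤ_p`): (i) = `F` irreducible over `ℚ_p`;
(ii) = the order `ℤ_p[T]/(F) = AdjoinRoot F` is integrally closed in its total fraction ring `A_K`, i.e. IS `A_𝒪`; (iii) = `p ≠ 2` and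
the local Tamagawa index `c_p = [E(ℚ_p) : E₀(ℚ_p)]` (tree: `localTamagawaNumber` over `ℤ_[p]`, model-independent) is odd; (iv) =
`p = 2` (`ℚ₂/ℚ₂` is unramified) and `E` has good reduction at `2` (tree: `HasGoodReductionAtPrime`, model-independent).
[cite: BarrerasalazarPacettiTornaria2021, Def. 1.6] -/
def SatisfiesDaggerAt (a₂ a₄ a₆ : ℤ) (p : ℕ) [Fact p.Prime] : Prop :=
  Irreducible ((cubicF a₂ a₄ a₆).map (Int.castRingHom ℚ_[p])) ∨
    IsIntegrallyClosed (AdjoinRoot ((cubicF a₂ a₄ a₆).map (Int.castRingHom ℤ_[p]))) ∨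
    (p ≠ 2 ∧ Odd (((curve a₂ a₄ a₆).baseChange ℚ_[p]).localTamagawaNumber ℤ_[p])) ∨
    (p = 2 ∧ (curve a₂ a₄ a₆).HasGoodReductionAtPrime p)

/-! ## Hypotheses 2.1 (for `K = ℚ`) -/

/-- **BPT 2021 Hypotheses 2.1** for `K = ℚ` and `E = curve a₂ a₄ a₆` (verbatim): «The elliptic curve `E` and the field `K`
satisfy: • the narrow class number of `K` is odd; • `E(K)[2] = {0}`; • for all finite places `v` of `K`, `E/K_v` satisfies (†).»
For `K = ℚ` the first clause holds (narrow class number `1`) and is omitted; the second is `E(ℚ)[2] = ⊥` for the Mordell–Weil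
group of the model; the third is `SatisfiesDaggerAt` at every prime.  (The paper notes that the second hypothesis makes `A_K` a
cubic FIELD.) [cite: BarrerasalazarPacettiTornaria2021, Hyp. 2.1] -/
def Hypotheses21 (a₂ a₄ a₆ : ℤ) : Prop :=
  AddSubgroup.torsionBy (curve a₂ a₄ a₆).toAffine.Point 2 = ⊥ ∧
    ∀ (p : ℕ) [Fact p.Prime], SatisfiesDaggerAt a₂ a₄ a₆ p

/-! ## Remark 1.2 / Definition 2.8: the distinguished real place and `P_*(E)`, `Cl_*(A_K,E)` (for `K = ℚ`) -/

section ClassGroup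

variable (A : Type) [Field A]

/-- A real embedding `σ` of the cubic field `A ∋ θ` (`F(θ) = 0`) is NOT the distinguished one: some real embedding sends `θ`
to a smaller real root.  BPT 2021 Remark 1.2 / Lemma 1.1 (ii): when `F` has three real roots `θ₁ < θ₂ < θ₃` and
`A_ℝ ≅ ℝ³` via `T ↦ (θ₁, θ₂, θ₃)`, the Kummer image at `∞` is `⟨(1,−1,−1)⟩` and the distinguished place `ṽ` is the FIRST
coordinate, i.e. the embedding with the smallest value at `θ`; the other two are `ṽ₂, ṽ₃`.  (With one real embedding — one
real root, `Disc F < 0`, type (i) — no embedding satisfies this.) [cite: BarrerasalazarPacettiTornaria2021, Rem. 1.2, Lemma 1.1] -/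
def IsNonDistinguished (θ : A) (σ : A →+* ℝ) : Prop :=
  ∃ ρ : A →+* ℝ, ρ θ < σ θ

/-- **BPT 2021 Definition 2.8 / display before Lemma 2.7, `P_*(E)` restricted to integral ideals, `K = ℚ`:** the nonzero
principal ideal `I = (α)` of `𝓞_A` lies in `P_*(E) = {(α) ∈ P : ṽ₂(α)·ṽ₃(α) > 0 for all real places v of K of type (ii)}` —
i.e. SOME generator `α` has `σ α · τ α > 0` for every pair of distinct non-distinguished real embeddings `σ, τ` (over `ℚ` there
is one real place; it is of type (ii) iff `A` has three real embeddings, and then the pair is `{ṽ₂, ṽ₃}`; of type (i) iff `A` has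
one real embedding, and then the condition is empty and `P_*(E) = P`).  `P₊ ⊂ P_*(E) ⊂ P`.
[cite: BarrerasalazarPacettiTornaria2021, Def. 2.8 (P_*(E))] -/
def IsPStarIdeal (θ : A) (I : Ideal (𝓞 A)) : Prop :=
  ∃ α : 𝓞 A, α ≠ 0 ∧ I = Ideal.span {α} ∧
    ∀ σ τ : A →+* ℝ, σ ≠ τ → IsNonDistinguished A θ σ → IsNonDistinguished A θ τ →
      0 < σ (α : A) * τ (α : A)

/-- **The quadratic characters of `Cl_*(A_K,E) = Frac(A_K)/P_*(E)` (BPT 2021 Definition 2.8), `K = ℚ`,** as functions on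
integral ideals: `χ : Ideal (𝓞 A) → ℤˣ` multiplicative on nonzero ideals, normalised by `χ ⊥ = 1`, and trivial on the integral
ideals of `P_*(E)`.  Since the nonzero integral ideals generate the free abelian group `Frac(A)` and every `(α) ∈ P_*(E)` is
`(a)·(n)⁻¹` with `a ∈ 𝓞_A`, `n ∈ ℕ⁺` both in `P_*(E)`, this set is in bijection with `Hom(Cl_*(A,E), ±1)`, so
`Nat.card (clStarQuadraticCharacters A θ) = #Cl_*(A,E)[2] = 2 ^ dim_{𝔽₂} Cl_*(A,E)[2]` — the quantity of Theorem 2.16, typed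
without a class-group object (same device as the tree's ray-class characters).  Remark 2.9: if `Cl₊(A) = Cl(A)` then
`Cl_*(A,E) = Cl(A)`. [cite: BarrerasalazarPacettiTornaria2021, Def. 2.8 (Cl_*(A_K,E))] -/
def clStarQuadraticCharacters (θ : A) : Set (Ideal (𝓞 A) → ℤˣ) :=
  {χ | (∀ I J : Ideal (𝓞 A), I ≠ ⊥ → J ≠ ⊥ → χ (I * J) = χ I * χ J) ∧ χ ⊥ = 1 ∧
       ∀ I : Ideal (𝓞 A), IsPStarIdeal A θ I → χ I = 1}

/-- The trivial character is a quadratic character of `Cl_*(A,E)` (so the set is nonempty and `Nat.card = 2 ^ k` has the floor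
`k = 0`). [cite: BarrerasalazarPacettiTornaria2021, Def. 2.8] -/
theorem one_mem_clStarQuadraticCharacters (θ : A) : (fun _ => 1) ∈ clStarQuadraticCharacters A θ := by
  refine ⟨?_, rfl, ?_⟩
  · intro I J _ _; simp
  · intro I _; rfl

/-- With at most one real embedding (type (i): `Disc F < 0`, one real root) no embedding is non-distinguished…
[cite: BarrerasalazarPacettiTornaria2021, Rem. 1.2] -/
theorem not_isNonDistinguished_of_subsingleton [Subsingleton (A →+* ℝ)] (θ : A) (σ : A →+* ℝ) :
    ¬ IsNonDistinguished A θ σ := by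
  rintro ⟨ρ, hρ⟩
  rw [Subsingleton.elim ρ σ] at hρ
  exact lt_irrefl _ hρ

/-- … so `P_*(E)` is ALL nonzero principal ideals: the paper's «if `Disc(E) < 0` then `Cl_*(A_ℚ,E) = Cl(A_ℚ)` (in particular it
does not depend on the elliptic curve `E`)» (after Thm 2.16), at the level of `P_*(E) = P`.
[cite: BarrerasalazarPacettiTornaria2021, Thm. 2.16 (remark following), Rem. 2.9] -/
theorem isPStarIdeal_iff_of_subsingleton [Subsingleton (A →+* ℝ)] (θ : A) (I : Ideal (𝓞 A)) :
    IsPStarIdeal A θ I ↔ ∃ α : 𝓞 A, α ≠ 0 ∧ I = Ideal.span {α} := by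
  constructor
  · rintro ⟨α, hα, hI, -⟩
    exact ⟨α, hα, hI⟩
  · rintro ⟨α, hα, hI⟩
    refine ⟨α, hα, hI, ?_⟩
    intro σ τ hστ _ _
    exact absurd (Subsingleton.elim σ τ) hστ

/-- … hence with at most one real embedding the quadratic characters of `Cl_*(A,E)` are exactly the quadratic characters of
the class group `Cl(A)` (functions on integral ideals, multiplicative on nonzero ideals, `χ ⊥ = 1`, trivial on nonzero principal
ideals): `Cl_*(A_ℚ,E)[2] = Cl(A_ℚ)[2]` when `Disc(E) < 0`. [cite: BarrerasalazarPacettiTornaria2021, Thm. 2.16 (remark following)] -/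
theorem clStarQuadraticCharacters_eq_of_subsingleton [Subsingleton (A →+* ℝ)] (θ : A) :
    clStarQuadraticCharacters A θ =
      {χ | (∀ I J : Ideal (𝓞 A), I ≠ ⊥ → J ≠ ⊥ → χ (I * J) = χ I * χ J) ∧ χ ⊥ = 1 ∧
        ∀ α : 𝓞 A, α ≠ 0 → χ (Ideal.span {α}) = 1} := by
  ext χ
  simp only [clStarQuadraticCharacters, Set.mem_setOf_eq, isPStarIdeal_iff_of_subsingleton]
  refine ⟨fun ⟨h1, h2, h3⟩ => ⟨h1, h2, fun α hα => h3 _ ⟨α, hα, rfl⟩⟩, fun ⟨h1, h2, h3⟩ => ⟨h1, h2, ?_⟩⟩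
  rintro I ⟨α, hα, rfl⟩
  exact h3 α hα

end ClassGroup

/-! ## Theorem 2.16 for `K = ℚ` (named fact) -/

/-- **Barrera Salazar–Pacetti–Tornaría 2021, Theorem 2.16, for `K = ℚ`** (verbatim): «Let `K` be a number field and let `E/K`
be an elliptic curve satisfying hypotheses 2.1.  Then `dim_{𝔽₂} Cl_*(A_K,E)[2] ≤ dim_{𝔽₂} Sel₂(E) ≤ dim_{𝔽₂} Cl_*(A_K,E)[2] + [K:ℚ]`.
In particular, if `K = ℚ`, the order of the Selmer group is determined by the `2`-torsion of `Cl_*(A_K,E)` and the root number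
of `E`.»  (Proof in print: `M₁(E) ⊂ Sel₂(E) ⊂ M₂(E)` (Prop. 2.6), `M₁(E) ≅ Cl_*(A_K,E)[2]` (Prop. 2.10, Artin reciprocity),
`[M₂(E) : M₁(E)] ≤ 2^{[K:ℚ]}` (Thm. 2.11).)  Typed for `K = ℚ`, `E = curve a₂ a₄ a₆ : y² = F(x)` elliptic (`F` square-free),
Hypotheses 2.1, `A` a cubic number field with a root `θ` of `F` (so `A ≅ A_ℚ = ℚ[T]/(F)`, `T ↦ θ`, because `E(ℚ)[2] = 0` makes `F`
irreducible): if `#Hom(Cl_*(A,E), ±1) = 2 ^ k` then `#Sel₂(E/ℚ) = 2 ^ s` with `k ≤ s ≤ k + 1` (`[ℚ:ℚ] = 1`; `Sel₂(E/ℚ)` = the tree's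
cohomological `selmerGroup _ 2`, equal to the paper's Kummer-condition Selmer group of Def. 2.2).  The paper adds: «if
`Disc(E) < 0` then `Cl_*(A_ℚ,E) = Cl(A_ℚ)`» (see `clStarQuadraticCharacters_eq_of_subsingleton`).
-- TODO(general form): arbitrary number field `K` with odd narrow class number, places of types (i)/(ii)/(iii), upper slack `[K:ℚ]`.
[cite: BarrerasalazarPacettiTornaria2021, Thm. 2.16] -/
def twoSelmerRank_clStar_bounds : Prop :=
  ∀ (a₂ a₄ a₆ : ℤ) [(curve a₂ a₄ a₆).IsElliptic], Hypotheses21 a₂ a₄ a₆ →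
    ∀ (A : Type) [Field A] [NumberField A] (θ : A), Module.finrank ℚ A = 3 →
      θ ^ 3 + (a₂ : A) * θ ^ 2 + (a₄ : A) * θ + (a₆ : A) = 0 →
      ∀ k : ℕ, Nat.card (clStarQuadraticCharacters A θ) = 2 ^ k →
        ∃ s : ℕ, Nat.card ((curve a₂ a₄ a₆).selmerGroup 2) = 2 ^ s ∧ k ≤ s ∧ s ≤ k + 1

/-- The paper's «In particular, if `K = ℚ`, the order of the Selmer group is determined by the `2`-torsion of `Cl_*(A_K,E)` and the
root number of `E`» made explicit: `#Sel₂(E/ℚ) = 2 ^ k` if `w(E) = (−1)^k` and `= 2 ^ (k+1)` otherwise (`2 ^ k = #Hom(Cl_*(A,E), ±1)`)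
— Theorem 2.16 (the named fact `twoSelmerRank_clStar_bounds`) combined with the `2`-Selmer parity theorem `(−1)^{dim Sel₂(E)} = w(E)`
for `E(ℚ)[2] = 0` (Monsky 1996; Dokchitser–Dokchitser 2010 — the tree's named fact `even_selmerRank_sub_torsionRank_iff`).
[cite: BarrerasalazarPacettiTornaria2021, Thm. 2.16 (in particular)] -/
theorem natCard_selmerGroup_eq_of_rootNumber (h : twoSelmerRank_clStar_bounds)
    (hDD : even_selmerRank_sub_torsionRank_iff) (a₂ a₄ a₆ : ℤ) [(curve a₂ a₄ a₆).IsElliptic]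
    (hyp : Hypotheses21 a₂ a₄ a₆) (A : Type) [Field A] [NumberField A] (θ : A) (hA : Module.finrank ℚ A = 3)
    (hθ : θ ^ 3 + (a₂ : A) * θ ^ 2 + (a₄ : A) * θ + (a₆ : A) = 0) (k : ℕ)
    (hk : Nat.card (clStarQuadraticCharacters A θ) = 2 ^ k) :
    Nat.card ((curve a₂ a₄ a₆).selmerGroup 2) =
      if (curve a₂ a₄ a₆).rootNumber = (-1) ^ k then 2 ^ k else 2 ^ (k + 1) := by
  obtain ⟨s, hs, hks, hsk⟩ := h a₂ a₄ a₆ hyp A θ hA hθ k hk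
  have ht : Nat.card (AddSubgroup.torsionBy (curve a₂ a₄ a₆).toAffine.Point ((2 : ℕ) : ℤ)) = 2 ^ 0 := by
    have h2 : ((2 : ℕ) : ℤ) = 2 := by norm_num
    rw [h2, hyp.1, pow_zero]
    exact AddSubgroup.card_bot
  have hpar := hDD (curve a₂ a₄ a₆) 2 s 0 (by exact_mod_cast hs) ht
  simp only [Nat.cast_zero, sub_zero, Int.even_coe_nat] at hpar
  have hw := (curve a₂ a₄ a₆).rootNumber_eq_one_or
  rcases (show s = k ∨ s = k + 1 by omega) with rfl | rfl
  · -- `dim Sel₂ = k`: parity forces `w(E) = (−1)^k`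
    have : (curve a₂ a₄ a₆).rootNumber = (-1) ^ s := by
      rcases Nat.even_or_odd s with he | ho
      · rw [hpar.mp he, Even.neg_one_pow he]
      · have hne : (curve a₂ a₄ a₆).rootNumber ≠ 1 := fun h1 => (Nat.not_even_iff_odd.mpr ho) (hpar.mpr h1)
        rw [hw.resolve_left hne, Odd.neg_one_pow ho]
    rw [hs, if_pos this]
  · -- `dim Sel₂ = k + 1`: parity forces `w(E) ≠ (−1)^k`
    have : (curve a₂ a₄ a₆).rootNumber ≠ (-1) ^ k := by
      rcases Nat.even_or_odd k with he | ho
      · rw [Even.neg_one_pow he]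
        exact fun h1 => Nat.not_even_iff_odd.mpr (Even.add_one he) (hpar.mpr h1)
      · rw [Odd.neg_one_pow ho, hpar.mp (Odd.add_one ho)]
        norm_num
    rw [hs, if_neg this]

end Literature.NumberTheory.EllipticCurves.BPT2021

end
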